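import Literature.Topology.FourManifolds.FoxMilnorChart
import Literature.Topology.FourManifolds.NearIdentityIsotopy
import Mathlib.Analysis.Calculus.InverseFunctionTheorem.ContDiff
import HarnessLib

/-!
# Making a flat arc of a knot unit-speed by an ambient isotopy

Topic `Literature/Topology/FourManifolds`; preparatory step of the proof programme of the
Fox–Milnor fact `Literature.Topology.FourManifolds.Knot.exists_isConnectedSum_isConcordant` (the
two end knots of a conical concordance must traverse *the same* straight segment with *the same*
parametrisation near a common parameter; after this file only a rotation of the parameter is
needed). Everything here is proved; no named fact is introduced.

Let `K` be a knot off the south pole whose chart image traverses the straight segment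
`p + σ θ • e` for `θ ∈ [α, β]` (`σ' > 0`, `σ θ₁ = 0`), normalised by a homothety so that
`σ' θ₁ = 1`. **Then an ambient isotopy of `𝕊³` whose orbit of `K` stays off the south pole makes
the traversal unit-speed near `θ₁`**: `ψ (G₁ (K (circlePoint θ))) = p + (θ - θ₁) • e` for
`|θ - θ₁| ≤ ζ` (`Knot.exists_ambientIsotopy_unitSpeed`). Construction: with the local inverse
`τ = σ⁻¹` near `0` (inverse function theorem, `exists_localInverse_of_deriv_pos`) the correction
`G u = τ u - θ₁ - u` vanishes to second order at `0`, so its cut-off `g` at scale `u₀` has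
`|g| ≤ C u₀²`, `|g'| ≤ C u₀` (`exists_cutoff_correction`); the shear `v x = χ (x) g ⟪x - p, e⟫ e`
along the segment then has `‖Dv‖ ≤ 1/2` for small `u₀`, its straight-line isotopy
(`perturbationIsotopy`, `NearIdentityIsotopy.lean`) is an ambient isotopy of `ℝ³` with compact
support moving `p + σ θ e` to `p + (θ - θ₁) e`, and it is transported to `𝕊³` along `ψ`
(`AmbientIsotopy.alongChart`).

## References

* M. W. Hirsch, *Differential Topology*, GTM 33 (1976), Ch. 2 §1 (Lemma 1.3), Ch. 8 §1.
  [HirschDT1976]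

## Design notes

No named facts, no `sorry`; `𝔼 n`, `𝕊 n` are local notation as in `Knots.lean`.
-/

open scoped Manifold Topology ContDiff Real RealInnerProductSpace
open Function Set Metric Filter

noncomputable section

namespace Literature.Topology.FourManifolds

/-- Local notation: `𝔼 n` is the model Euclidean space `EuclideanSpace ℝ (Fin n)`. -/
local notation "𝔼 " n:arg => EuclideanSpace ℝ (Fin n)

/-- Local notation: `𝕊 n` is the unit sphere in `EuclideanSpace ℝ (Fin (n + 1))`. -/
local notation "𝕊 " n:arg => (Metric.sphere (0 : EuclideanSpace ℝ (Fin (n + 1))) 1)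

attribute [local instance] fact_finrank_euclideanSpace_succ

namespace UnitSpeedArc

/-! ### The local inverse of the segment coordinate -/

/-- **Local inverse of a function with positive derivative** (inverse function theorem in one
variable): an open `V ∋ σ θ₁`, a `C^∞` inverse `τ` on `V` with values in `(α, β)`, and an open
`W ∋ θ₁` mapped into `V` on which `τ ∘ σ = id`. [folklore] -/
theorem exists_localInverse_of_deriv_pos {σ : ℝ → ℝ} (hσ : ContDiff ℝ ∞ σ) {α β θ₁ : ℝ}
    (hα : α < θ₁) (hβ : θ₁ < β) (hd : ∀ θ ∈ Icc α β, 0 < deriv σ θ) :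
    ∃ (τ : ℝ → ℝ) (V W : Set ℝ), IsOpen V ∧ σ θ₁ ∈ V ∧ ContDiffOn ℝ ∞ τ V ∧
      (∀ u ∈ V, σ (τ u) = u ∧ τ u ∈ Ioo α β ∧ τ u ∈ W) ∧
      IsOpen W ∧ θ₁ ∈ W ∧ W ⊆ Ioo α β ∧ ∀ θ ∈ W, σ θ ∈ V ∧ τ (σ θ) = θ := by
  have hθ₁ : θ₁ ∈ Icc α β := ⟨hα.le, hβ.le⟩
  have hne : deriv σ θ₁ ≠ 0 := (hd θ₁ hθ₁).ne'
  have hdiff : Differentiable ℝ σ := hσ.differentiable (by simp)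
  have hder : HasDerivAt σ (deriv σ θ₁) θ₁ := (hdiff θ₁).hasDerivAt
  set e₀ := hσ.contDiffAt.toOpenPartialHomeomorph σ (hder.hasFDerivAt_equiv hne) (by simp) with he₀
  have he₀c : (e₀ : ℝ → ℝ) = σ := rfl
  set e := e₀.restrOpen (Ioo α β) isOpen_Ioo with he
  have hec : (e : ℝ → ℝ) = σ := rfl
  have hsrc : e.source = e₀.source ∩ Ioo α β := e₀.restrOpen_source _ _
  have hθ₁s : θ₁ ∈ e.source := by
    rw [hsrc]
    exact ⟨hσ.contDiffAt.mem_toOpenPartialHomeomorph_source (hder.hasFDerivAt_equiv hne) (by simp), hα, hβ⟩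
  refine ⟨e.symm, e.target, e.source, e.open_target, ?_, ?_, ?_, e.open_source, hθ₁s, ?_, ?_⟩
  · have := e.map_source hθ₁s; rwa [hec] at this
  · intro u hu
    have hτu : e.symm u ∈ Ioo α β := by
      have := e.map_target hu; rw [hsrc] at this; exact this.2
    have hdu : deriv σ (e.symm u) ≠ 0 := (hd _ (Ioo_subset_Icc_self hτu)).ne'
    exact (e.contDiffAt_symm_deriv hdu hu (by rw [hec]; exact (hdiff _).hasDerivAt)
      (by rw [hec]; exact hσ.contDiffAt)).contDiffWithinAt
  · intro u hu
    have hτs := e.map_target hu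
    refine ⟨?_, ?_, hτs⟩
    · have := e.right_inv hu; rwa [hec] at this
    · rw [hsrc] at hτs; exact hτs.2
  · intro θ hθ; rw [hsrc] at hθ; exact hθ.2
  · intro θ hθ
    refine ⟨?_, ?_⟩
    · have := e.map_source hθ; rwa [hec] at this
    · have := e.left_inv hθ; rwa [hec] at this

/-! ### One-variable estimates: a function vanishing to second order -/

/-- **A `C²` function with `G 0 = 0`, `G' 0 = 0` satisfies `|G' u| ≤ M |u|` and `|G u| ≤ M u²`
on a symmetric interval inside its domain of smoothness** (mean value inequality twice).
[folklore] -/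
theorem exists_bound_of_vanishing {G : ℝ → ℝ} {V : Set ℝ} (hV : IsOpen V) (hG : ContDiffOn ℝ ∞ G V)
    (h0 : G 0 = 0) (h0' : deriv G 0 = 0) {u₁ : ℝ} (hu₁ : 0 < u₁) (hI : Icc (-u₁) u₁ ⊆ V) :
    ∃ M : ℝ, 0 < M ∧ (∀ u ∈ Icc (-u₁) u₁, |deriv G u| ≤ M * |u|) ∧
      ∀ u ∈ Icc (-u₁) u₁, |G u| ≤ M * u ^ 2 := by
  have hG1 : ContDiffOn ℝ 1 (deriv G) V := hG.deriv_of_isOpen hV (by norm_cast)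
  have hG2 : ContinuousOn (deriv (deriv G)) V :=
    (hG1.deriv_of_isOpen (m := 0) hV (by norm_num)).continuousOn
  obtain ⟨M₀, hM₀⟩ := isCompact_Icc.exists_bound_of_continuousOn (hG2.mono hI)
  set M : ℝ := max M₀ 1 with hM
  have hMpos : 0 < M := lt_of_lt_of_le one_pos (le_max_right _ _)
  have hdd : ∀ u ∈ V, DifferentiableAt ℝ (deriv G) u := fun u hu ↦
    (hG1.contDiffAt (hV.mem_nhds hu)).differentiableAt (by simp)
  have hd : ∀ u ∈ V, DifferentiableAt ℝ G u := fun u hu ↦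
    (hG.contDiffAt (hV.mem_nhds hu)).differentiableAt (by simp)
  have h0mem : (0 : ℝ) ∈ Icc (-u₁) u₁ := ⟨by linarith, by linarith⟩
  -- first derivative
  have hder : ∀ u ∈ Icc (-u₁) u₁, |deriv G u| ≤ M * |u| := by
    intro u hu
    have := (convex_Icc (-u₁) u₁).norm_image_sub_le_of_norm_deriv_le (f := deriv G) (C := M)
      (fun x hx ↦ hdd x (hI hx)) (fun x hx ↦ (hM₀ x hx).trans (le_max_left M₀ 1)) h0mem hu
    rw [h0', sub_zero, sub_zero, Real.norm_eq_abs, Real.norm_eq_abs] at this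
    exact this
  refine ⟨M, hMpos, hder, fun u hu ↦ ?_⟩
  -- the function itself, on the segment from `0` to `u`
  have hseg : uIcc 0 u ⊆ Icc (-u₁) u₁ := by
    rcases le_or_gt 0 u with h | h
    · rw [uIcc_of_le h]; exact Icc_subset_Icc (by linarith) hu.2
    · rw [uIcc_of_ge h.le]; exact Icc_subset_Icc hu.1 (by linarith)
  have hbound : ∀ x ∈ uIcc 0 u, ‖deriv G x‖ ≤ M * |u| := by
    intro x hx
    rw [Real.norm_eq_abs]
    refine (hder x (hseg hx)).trans (mul_le_mul_of_nonneg_left ?_ hMpos.le)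
    rcases le_or_gt 0 u with h | h
    · rw [uIcc_of_le h] at hx; rw [abs_of_nonneg hx.1, abs_of_nonneg h]; exact hx.2
    · rw [uIcc_of_ge h.le] at hx; rw [abs_of_nonpos hx.2, abs_of_neg h]; linarith [hx.1]
  have := (convex_uIcc 0 u).norm_image_sub_le_of_norm_deriv_le (f := G)
    (fun x hx ↦ hd x (hI (hseg hx))) hbound left_mem_uIcc right_mem_uIcc
  rw [h0, sub_zero, sub_zero, Real.norm_eq_abs, Real.norm_eq_abs] at this
  calc |G u| ≤ M * |u| * |u| := this
    _ = M * u ^ 2 := by rw [mul_assoc, ← sq, sq_abs]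

/-! ### The cut-off correction -/

/-- **The cut-off correction at scale `u₀`.** For `G` smooth on an open `V ∋ 0` vanishing to
second order at `0` there is `C > 0` such that for every sufficiently small `u₀ > 0` there is a
`C^∞` function `g : ℝ → ℝ` with `g = G` on `[-u₀, u₀]`, `g = 0` off `(-2u₀, 2u₀)`,
`|g| ≤ C u₀²` and `|g'| ≤ C u₀` everywhere. [folklore] -/
theorem exists_cutoff_correction {G : ℝ → ℝ} {V : Set ℝ} (hV : IsOpen V) (h0V : (0 : ℝ) ∈ V)
    (hG : ContDiffOn ℝ ∞ G V) (h0 : G 0 = 0) (h0' : deriv G 0 = 0) :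
    ∃ (C u₁ : ℝ), 0 < C ∧ 0 < u₁ ∧ ∀ u₀ : ℝ, 0 < u₀ → 2 * u₀ ≤ u₁ →
      ∃ g : ℝ → ℝ, ContDiff ℝ ∞ g ∧ (∀ u, |u| ≤ u₀ → g u = G u) ∧ (∀ u, 2 * u₀ ≤ |u| → g u = 0) ∧
        (∀ u, |g u| ≤ C * u₀ ^ 2) ∧ ∀ u, |deriv g u| ≤ C * u₀ := by
  -- a compact symmetric interval inside `V`
  obtain ⟨u₁, hu₁, hball⟩ := Metric.isOpen_iff.1 hV 0 h0V
  have hI : Icc (-(u₁ / 2)) (u₁ / 2) ⊆ V := fun u hu ↦ hball (by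
    rw [mem_ball, dist_zero_right, Real.norm_eq_abs, abs_lt]; constructor <;> linarith [hu.1, hu.2])
  obtain ⟨M, hM, hder, hval⟩ := exists_bound_of_vanishing hV hG h0 h0' (by positivity) hI
  -- a fixed bump and its derivative bound
  let χ : ContDiffBump (0 : ℝ) := ⟨1, 2, one_pos, by norm_num⟩
  have hχc : ContDiff ℝ ∞ (χ : ℝ → ℝ) := χ.contDiff
  obtain ⟨C₀, hC₀⟩ := (χ.hasCompactSupport.deriv).exists_bound_of_continuous
    (hχc.continuous_deriv (by simp))
  set Cχ : ℝ := max C₀ 0 with hCχ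
  have hCχ0 : 0 ≤ Cχ := le_max_right _ _
  have hCχb : ∀ z, |deriv (χ : ℝ → ℝ) z| ≤ Cχ := fun z ↦
    ((Real.norm_eq_abs _).symm.le.trans (hC₀ z)).trans (le_max_left _ _)
  refine ⟨4 * M * (Cχ + 1), u₁ / 2, by positivity, by positivity, fun u₀ hu₀ hu₀₁ ↦ ?_⟩
  set χ₁ : ℝ → ℝ := fun u ↦ (χ : ℝ → ℝ) (u₀⁻¹ * u) with hχ₁
  have hχ₁c : ContDiff ℝ ∞ χ₁ := hχc.comp (contDiff_const.mul contDiff_id)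
  have hχ₁_one : ∀ u, |u| ≤ u₀ → χ₁ u = 1 := by
    intro u hu
    apply χ.one_of_mem_closedBall
    show u₀⁻¹ * u ∈ closedBall (0 : ℝ) 1
    rw [mem_closedBall, dist_zero_right, Real.norm_eq_abs, abs_mul, abs_inv, abs_of_pos hu₀,
      inv_mul_le_iff₀ hu₀, mul_one]
    exact hu
  have hχ₁_zero : ∀ u, 2 * u₀ ≤ |u| → χ₁ u = 0 := by
    intro u hu
    apply χ.zero_of_le_dist
    show (2 : ℝ) ≤ dist (u₀⁻¹ * u) 0
    rw [dist_zero_right, Real.norm_eq_abs, abs_mul, abs_inv, abs_of_pos hu₀, le_inv_mul_iff₀ hu₀]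
    linarith
  have hχ₁_le : ∀ u, |χ₁ u| ≤ 1 := fun u ↦ by
    rw [abs_of_nonneg (χ.nonneg' _)]; exact χ.le_one
  have hχ₁_deriv : ∀ u, |deriv χ₁ u| ≤ Cχ / u₀ := by
    intro u
    have h1 : HasDerivAt χ₁ (deriv (χ : ℝ → ℝ) (u₀⁻¹ * u) * u₀⁻¹) u := by
      have hl : HasDerivAt (fun u : ℝ ↦ u₀⁻¹ * u) u₀⁻¹ u := by
        simpa using (hasDerivAt_id u).const_mul u₀⁻¹
      exact ((hχc.differentiable (by simp)) _).hasDerivAt.comp u hl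
    rw [h1.deriv, abs_mul, abs_inv, abs_of_pos hu₀, div_eq_mul_inv]
    gcongr
    exact hCχb _
  -- the correction
  set g : ℝ → ℝ := fun u ↦ χ₁ u * G u with hg
  have hg_zero : ∀ u, 2 * u₀ ≤ |u| → g u = 0 := fun u hu ↦ by simp [hg, hχ₁_zero u hu]
  have hsupp : ∀ u, g u ≠ 0 → |u| < 2 * u₀ := fun u hu ↦ by
    by_contra h; exact hu (hg_zero u (not_lt.1 h))
  have hin : ∀ u, |u| ≤ 2 * u₀ → u ∈ Icc (-(u₁ / 2)) (u₁ / 2) := fun u hu ↦ by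
    rw [abs_le] at hu; constructor <;> linarith
  have hgc : ContDiff ℝ ∞ g := by
    rw [contDiff_iff_contDiffAt]
    intro u
    by_cases hu : u ∈ V
    · exact hχ₁c.contDiffAt.mul (hG.contDiffAt (hV.mem_nhds hu))
    · have hfar : 2 * u₀ < |u| := by
        by_contra h; exact hu (hI (hin u (not_lt.1 h)))
      refine (contDiffAt_const (c := (0 : ℝ))).congr_of_eventuallyEq ?_
      have hO : IsOpen {w : ℝ | 2 * u₀ < |w|} := isOpen_lt continuous_const continuous_abs
      filter_upwards [hO.mem_nhds hfar] with w hw using hg_zero w (le_of_lt hw)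
  refine ⟨g, hgc, fun u hu ↦ by simp [hg, hχ₁_one u hu], hg_zero, fun u ↦ ?_, fun u ↦ ?_⟩
  · -- `|g| ≤ 4 M u₀² ≤ C u₀²`
    by_cases hu : |u| ≤ 2 * u₀
    · have h1 := hval u (hin u hu)
      have hsq : u ^ 2 ≤ (2 * u₀) ^ 2 := by
        rw [← sq_abs]; exact pow_le_pow_left₀ (abs_nonneg u) hu 2
      calc |g u| = |χ₁ u| * |G u| := abs_mul _ _
        _ ≤ 1 * (M * u ^ 2) := by gcongr; exact hχ₁_le u
        _ ≤ M * (2 * u₀) ^ 2 := by rw [one_mul]; exact mul_le_mul_of_nonneg_left hsq hM.le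
        _ = 4 * M * 1 * u₀ ^ 2 := by ring
        _ ≤ 4 * M * (Cχ + 1) * u₀ ^ 2 := by gcongr; linarith
    · rw [hg_zero u (le_of_lt (not_le.1 hu)), abs_zero]; positivity
  · -- `|g'| ≤ (Cχ/u₀) (4 M u₀²) + 2 M u₀ ≤ C u₀`
    by_cases hu : |u| ≤ 2 * u₀
    · have huV : u ∈ V := hI (hin u hu)
      have hGd : HasDerivAt G (deriv G u) u :=
        ((hG.contDiffAt (hV.mem_nhds huV)).differentiableAt (by simp)).hasDerivAt
      have hχd : HasDerivAt χ₁ (deriv χ₁ u) u := ((hχ₁c.differentiable (by simp)) u).hasDerivAt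
      have hprod : HasDerivAt g (deriv χ₁ u * G u + χ₁ u * deriv G u) u := hχd.mul hGd
      rw [hprod.deriv]
      have h1 := hval u (hin u hu)
      have h2 := hder u (hin u hu)
      have hsq : u ^ 2 ≤ (2 * u₀) ^ 2 := by
        rw [← sq_abs]; exact pow_le_pow_left₀ (abs_nonneg u) hu 2
      have hCu : 0 ≤ Cχ / u₀ := by positivity
      calc |deriv χ₁ u * G u + χ₁ u * deriv G u|
          ≤ |deriv χ₁ u| * |G u| + |χ₁ u| * |deriv G u| := by
            refine (abs_add_le _ _).trans ?_; rw [abs_mul, abs_mul]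
        _ ≤ Cχ / u₀ * (M * u ^ 2) + 1 * (M * |u|) := by
            gcongr
            · exact hχ₁_deriv u
            · exact hχ₁_le u
        _ ≤ Cχ / u₀ * (M * (2 * u₀) ^ 2) + 1 * (M * (2 * u₀)) := by
            gcongr
        _ = 4 * M * (Cχ + 2⁻¹) * u₀ := by field_simp; ring
        _ ≤ 4 * M * (Cχ + 1) * u₀ := by gcongr; norm_num
    · push Not at hu
      have hev : g =ᶠ[𝓝 u] fun _ ↦ (0 : ℝ) := by
        have hO : IsOpen {w : ℝ | 2 * u₀ < |w|} := isOpen_lt continuous_const continuous_abs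
        filter_upwards [hO.mem_nhds hu] with w hw using hg_zero w (le_of_lt hw)
      rw [hev.deriv_eq, deriv_const, abs_zero]
      positivity

/-! ### The shear field along the segment -/

/-- **The shear field** `v x = χ₂ (x) g (⟪e, x⟫ - ⟪e, p⟫) • e` of a correction `g` with
`|g| ≤ A`, `|g'| ≤ B` (`χ₂` a fixed bump of radii `1, 2` at `p`, `‖e‖ = 1`): `C^∞`, supported in
`B̄(p, 2)`, equal to `g u • e` at `p + u • e` for `|u| ≤ 1`, with `‖Dv‖ ≤ B + C₂ A` for a
constant `C₂` depending only on the bump. [folklore] -/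
theorem exists_shearField (p e : 𝔼 3) (he : ‖e‖ = 1) :
    ∃ C₂ : ℝ, 0 ≤ C₂ ∧ ∀ (g : ℝ → ℝ), ContDiff ℝ ∞ g → ∀ (A B : ℝ), (∀ u, |g u| ≤ A) →
      (∀ u, |deriv g u| ≤ B) →
      ∃ v : 𝔼 3 → 𝔼 3, ContDiff ℝ ∞ v ∧ (∀ x, ‖fderiv ℝ v x‖ ≤ B + C₂ * A) ∧
        (∀ x, 2 ≤ dist x p → v x = 0) ∧ ∀ u : ℝ, |u| ≤ 1 → v (p + u • e) = g u • e := by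
  let χ₂ : ContDiffBump p := ⟨1, 2, one_pos, by norm_num⟩
  have hχc : ContDiff ℝ ∞ (χ₂ : 𝔼 3 → ℝ) := χ₂.contDiff
  obtain ⟨C₀, hC₀⟩ := (χ₂.hasCompactSupport.fderiv ℝ).exists_bound_of_continuous
    (hχc.continuous_fderiv (by simp))
  set C₂ : ℝ := max C₀ 0 with hC₂
  have hC₂0 : 0 ≤ C₂ := le_max_right _ _
  have hC₂b : ∀ z, ‖fderiv ℝ (χ₂ : 𝔼 3 → ℝ) z‖ ≤ C₂ := fun z ↦ (hC₀ z).trans (le_max_left _ _)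
  refine ⟨C₂, hC₂0, fun g hg A B hA hB ↦ ?_⟩
  have hA0 : 0 ≤ A := (abs_nonneg _).trans (hA 0)
  set L : 𝔼 3 →L[ℝ] ℝ := innerSL ℝ e with hL
  have hLn : ‖L‖ = 1 := by rw [hL, innerSL_apply_norm, he]
  set ℓ : 𝔼 3 → ℝ := fun x ↦ L x - ⟪e, p⟫ with hℓ
  have hℓd : ∀ x, HasFDerivAt ℓ L x := fun x ↦ L.hasFDerivAt.sub_const _
  have hℓc : ContDiff ℝ ∞ ℓ := L.contDiff.sub contDiff_const
  have hℓseg : ∀ u : ℝ, ℓ (p + u • e) = u := fun u ↦ by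
    simp only [hℓ, hL, innerSL_apply_apply, inner_add_right, real_inner_smul_right,
      real_inner_self_eq_norm_sq, he]
    ring
  set v : 𝔼 3 → 𝔼 3 := fun x ↦ ((χ₂ : 𝔼 3 → ℝ) x * g (ℓ x)) • e with hv
  have hvc : ContDiff ℝ ∞ v := (hχc.mul (hg.comp hℓc)).smul contDiff_const
  refine ⟨v, hvc, fun x ↦ ?_, fun x hx ↦ ?_, fun u hu ↦ ?_⟩
  · -- the derivative bound
    have h1 : HasFDerivAt (fun x ↦ g (ℓ x))
        (((1 : ℝ →L[ℝ] ℝ).smulRight (deriv g (ℓ x))).comp L) x :=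
      ((hg.differentiable (by simp)) (ℓ x)).hasDerivAt.hasFDerivAt.comp x (hℓd x)
    have h2 : HasFDerivAt (χ₂ : 𝔼 3 → ℝ) (fderiv ℝ (χ₂ : 𝔼 3 → ℝ) x) x :=
      ((hχc.differentiable (by simp)) x).hasFDerivAt
    have h3 : HasFDerivAt (fun x ↦ ((χ₂ : 𝔼 3 → ℝ) x * g (ℓ x)) • e)
        (((χ₂ : 𝔼 3 → ℝ) x • ((1 : ℝ →L[ℝ] ℝ).smulRight (deriv g (ℓ x))).comp L +
          g (ℓ x) • fderiv ℝ (χ₂ : 𝔼 3 → ℝ) x).smulRight e) x :=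
      (h2.mul h1).smul_const e
    have : v = fun x ↦ ((χ₂ : 𝔼 3 → ℝ) x * g (ℓ x)) • e := rfl
    rw [this, h3.fderiv, ContinuousLinearMap.norm_smulRight_apply, he, mul_one]
    have hn1 : ‖((1 : ℝ →L[ℝ] ℝ).smulRight (deriv g (ℓ x))).comp L‖ ≤ B := by
      refine (ContinuousLinearMap.opNorm_comp_le _ _).trans ?_
      rw [ContinuousLinearMap.norm_smulRight_apply, norm_one, one_mul, hLn, mul_one, Real.norm_eq_abs]
      exact hB _
    have hχ1 : ‖(χ₂ : 𝔼 3 → ℝ) x‖ ≤ 1 := by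
      rw [Real.norm_eq_abs, abs_of_nonneg (χ₂.nonneg' _)]; exact χ₂.le_one
    have hgA : ‖g (ℓ x)‖ ≤ A := by rw [Real.norm_eq_abs]; exact hA _
    calc ‖(χ₂ : 𝔼 3 → ℝ) x • ((1 : ℝ →L[ℝ] ℝ).smulRight (deriv g (ℓ x))).comp L +
          g (ℓ x) • fderiv ℝ (χ₂ : 𝔼 3 → ℝ) x‖
        ≤ ‖(χ₂ : 𝔼 3 → ℝ) x‖ * ‖((1 : ℝ →L[ℝ] ℝ).smulRight (deriv g (ℓ x))).comp L‖ +
          ‖g (ℓ x)‖ * ‖fderiv ℝ (χ₂ : 𝔼 3 → ℝ) x‖ := by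
          refine (norm_add_le _ _).trans ?_; rw [norm_smul, norm_smul]
      _ ≤ 1 * B + A * C₂ := by gcongr; exact hC₂b x
      _ = B + C₂ * A := by ring
  · have : (χ₂ : 𝔼 3 → ℝ) x = 0 := χ₂.zero_of_le_dist (by simpa using hx)
    simp [hv, this]
  · have hχ1 : (χ₂ : 𝔼 3 → ℝ) (p + u • e) = 1 := by
      apply χ₂.one_of_mem_closedBall
      show p + u • e ∈ closedBall p 1
      rw [mem_closedBall, dist_eq_norm, add_sub_cancel_left, norm_smul, he, mul_one, Real.norm_eq_abs]
      exact hu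
    simp only [hv, hχ1, one_mul, hℓseg]

end UnitSpeedArc

open UnitSpeedArc KnotsInBall

/-! ### Unit speed along a flat arc -/

/-- **Making a flat arc unit-speed by an ambient isotopy.** Let `K` be a knot off the south pole
whose chart image traverses the segment `p + σ θ • e` for `θ ∈ [α, β]`, `σ' > 0` on `[α, β]`,
`σ θ₁ = 0`, `σ' θ₁ = 1` (`α < θ₁ < β`, `‖e‖ = 1`). Then there is an ambient isotopy `G` of
`𝕊³`, whose orbit of `K` stays off the south pole, with
`ψ (G₁ (K (circlePoint θ))) = p + (θ - θ₁) • e` for `|θ - θ₁| ≤ ζ` (some `ζ > 0`).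
[folklore] -/
theorem Knot.exists_ambientIsotopy_unitSpeed (K : Knot) (hK : ∀ x, K x ≠ southPole) {p e : 𝔼 3}
    (he : ‖e‖ = 1) {σ : ℝ → ℝ} (hσ : ContDiff ℝ ∞ σ) {α β θ₁ : ℝ} (hα : α < θ₁) (hβ : θ₁ < β)
    (hd : ∀ θ ∈ Icc α β, 0 < deriv σ θ) (hσ₁ : σ θ₁ = 0) (hσ'₁ : deriv σ θ₁ = 1)
    (hseg : ∀ θ ∈ Icc α β, psi (K (circlePoint θ)) = p + σ θ • e) :
    ∃ G : AmbientIsotopy (𝓡 3) (𝕊 3), (∀ t x, G.toFun t (K x) ≠ southPole) ∧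
      ∃ ζ : ℝ, 0 < ζ ∧ ∀ θ ∈ Icc (θ₁ - ζ) (θ₁ + ζ),
        psi (G.toFun 1 (K (circlePoint θ))) = p + (θ - θ₁) • e := by
  -- ### the local inverse and the correction
  obtain ⟨τ, V, W, hV, h0V, hτ, hVprop, hW, hθ₁W, hWI, hWprop⟩ :=
    exists_localInverse_of_deriv_pos hσ hα hβ hd
  rw [hσ₁] at h0V
  have hτ0 : τ 0 = θ₁ := by have := (hWprop θ₁ hθ₁W).2; rwa [hσ₁] at this
  have hdiffσ : Differentiable ℝ σ := hσ.differentiable (by simp)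
  set Gc : ℝ → ℝ := fun u ↦ τ u - θ₁ - u with hGc
  have hGcV : ContDiffOn ℝ ∞ Gc V := (hτ.sub contDiffOn_const).sub contDiffOn_id
  have hGc0 : Gc 0 = 0 := by simp [hGc, hτ0]
  have hτd : HasDerivAt τ (deriv τ 0) 0 :=
    ((hτ.contDiffAt (hV.mem_nhds h0V)).differentiableAt (by simp)).hasDerivAt
  have hτ'0 : deriv τ 0 = 1 := by
    have hcomp : HasDerivAt (σ ∘ τ) (deriv σ (τ 0) * deriv τ 0) 0 := (hdiffσ (τ 0)).hasDerivAt.comp 0 hτd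
    have hev : σ ∘ τ =ᶠ[𝓝 0] id := by
      filter_upwards [hV.mem_nhds h0V] with u hu using (hVprop u hu).1
    have h1 : deriv (σ ∘ τ) 0 = 1 := by rw [hev.deriv_eq, deriv_id]
    rw [hcomp.deriv, hτ0, hσ'₁, one_mul] at h1
    exact h1
  have hGc'0 : deriv Gc 0 = 0 := by
    have : HasDerivAt Gc (deriv τ 0 - 1) 0 := (hτd.sub_const θ₁).sub (hasDerivAt_id 0)
    rw [this.deriv, hτ'0]; ring
  obtain ⟨C, u₁, hC, hu₁, hcut⟩ := exists_cutoff_correction hV h0V hGcV hGc0 hGc'0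
  -- ### the shear field and the scale
  obtain ⟨C₂, hC₂, hshear⟩ := exists_shearField p e he
  set u₀ : ℝ := min (u₁ / 2) (min 1 (1 / (4 * C * (1 + C₂)))) with hu₀
  have hu₀pos : 0 < u₀ := lt_min (by positivity) (lt_min one_pos (by positivity))
  have hu₀₁ : 2 * u₀ ≤ u₁ := by have := min_le_left (u₁ / 2) (min 1 (1 / (4 * C * (1 + C₂)))); linarith
  have hu₀one : u₀ ≤ 1 := (min_le_right _ _).trans (min_le_left _ _)
  have hu₀C : u₀ ≤ 1 / (4 * C * (1 + C₂)) := (min_le_right _ _).trans (min_le_right _ _)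
  obtain ⟨g, hgc, hg_eq, hg_zero, hgA, hgB⟩ := hcut u₀ hu₀pos hu₀₁
  obtain ⟨v, hvc, hvb, hv_zero, hv_seg⟩ := hshear g hgc (C * u₀ ^ 2) (C * u₀) hgA hgB
  have hbound : ∀ y, ‖fderiv ℝ v y‖ ≤ 1 / 2 := by
    intro y
    refine (hvb y).trans ?_
    have h1 : C * u₀ ≤ 1 / (4 * (1 + C₂)) := by
      rw [le_div_iff₀ (by positivity)] at hu₀C ⊢; nlinarith
    have h2 : C₂ * (C * u₀ ^ 2) ≤ C₂ * (C * u₀) := by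
      apply mul_le_mul_of_nonneg_left _ hC₂
      apply mul_le_mul_of_nonneg_left _ hC.le
      nlinarith
    have h3 : C₂ * (1 / (4 * (1 + C₂))) ≤ 1 / 4 := by
      rw [mul_one_div, div_le_div_iff₀ (by positivity) (by norm_num)]; nlinarith
    have h4 : 1 / (4 * (1 + C₂)) ≤ 1 / 4 := by
      rw [div_le_div_iff₀ (by positivity) (by norm_num)]; nlinarith
    nlinarith
  -- ### the straight-line isotopy and its transport to the sphere
  set F := perturbationIsotopy hvc hbound with hF
  have hR : ∀ t (y : 𝔼 3), ‖p‖ + 2 ≤ ‖y‖ → F.toFun t y = y := by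
    intro t y hy
    have hdist : 2 ≤ dist y p := by
      rw [dist_eq_norm]
      have := norm_sub_norm_le y p
      linarith [abs_le.1 (abs_norm_sub_norm_le y p)]
    simp [hF, perturbationStage, hv_zero y hdist]
  set G := F.alongChart (φ := psi) contMDiffOn_psi contMDiff_psi_symm psi_target hR with hG
  refine ⟨G, fun t x ↦ ?_, ?_⟩
  · rw [hG, AmbientIsotopy.alongChart_toFun, chartTransport_of_mem _ (mem_psi_source (hK x))]
    exact psi_symm_ne_southPole _
  -- ### the window
  have hO : IsOpen (W ∩ {θ | |σ θ| < u₀}) :=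
    hW.inter (isOpen_lt (continuous_abs.comp hσ.continuous) continuous_const)
  have hθ₁O : θ₁ ∈ W ∩ {θ | |σ θ| < u₀} := ⟨hθ₁W, by simp [hσ₁, hu₀pos]⟩
  obtain ⟨ζ, hζ, hballζ⟩ := Metric.isOpen_iff.1 hO θ₁ hθ₁O
  refine ⟨ζ / 2, by positivity, fun θ hθ ↦ ?_⟩
  have hθO : θ ∈ W ∩ {θ | |σ θ| < u₀} := hballζ (by
    rw [mem_ball, Real.dist_eq, abs_lt]; constructor <;> linarith [hθ.1, hθ.2])
  have hθW : θ ∈ W := hθO.1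
  have hσu₀ : |σ θ| < u₀ := hθO.2
  have hθI : θ ∈ Icc α β := Ioo_subset_Icc_self (hWI hθW)
  rw [hG, AmbientIsotopy.alongChart_toFun, chartTransport_of_mem _ (mem_psi_source (hK _)),
    psi_apply_psi_symm, hseg θ hθI]
  simp only [hF, perturbationIsotopy_toFun, perturbationStage,
    Real.smoothTransition.one_of_one_le le_rfl, one_smul]
  rw [hv_seg (σ θ) (hσu₀.le.trans hu₀one), hg_eq (σ θ) hσu₀.le]
  simp only [hGc, (hWprop θ hθW).2]
  rw [add_assoc, ← add_smul]
  congr 2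
  ring

end Literature.Topology.FourManifolds
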